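import Summits.CriticalPhenomena.PercolationContinuityZ3.Theorems.Transplant.SkelPhiNegReachRoomsCyL
import HarnessLib

/-!
# N1 (the `{±1}` node), (C) column file (C-S9g): THE BAND ROOMS BY CORRIDOR AXIS — the hypotheses `hrdB'`, `hrdB`, `hrdL`, `zB/hzB/hZ/hrdZ` of
# `reachOblRHN_negSG₂b_of_inputs` at the record values of RULING B.15/B.16, assembled from the x-band facts (C-S9d) for a u-corridor (`du.1 = 0`)
# and the y′-band facts (C-S9e/f) for a v-corridor (`du.1 = 1`): **`CorrRec.hrdC1 / hrdC0`** (regions, with / without margin), **`CorrRec.hrdLC`**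
# (last core in the arrival box `cen' ± (b₀ − 1)`), **`CorrRec.zB`** (habitat points) with **`zB_mem`**, **`zB_l1`** (`Zmax := 800·(n + W_B)`) and
# **`hrdZC`**, under the union of the band floors (`hbx1–3`, `hby1–3`) and target floors (`hxL1`, `hxL3`, `hyL1–3`).

builds on p205010 (kernel theorem, internal audit signed; external expert review pending) — nothing in this file uses p205010; nothing here is a
claim about the open node `SamePDropOfSkeletonNeg`.
Lane `prim-bschramm`, seat `prim-bschramm-p5` (gen 9; (C) lineage); helper file (`--supports stmt-CriticalPhenomena-4575`).
[cite: KozmaNitzan2024, §4 Lemma 11 (pp. 22–23), Lemma 12 (pp. 23–25), p. 26 (M_v, H_{v,x})] [cite: MartineauTassion2017, §4.3 Lemma 4.2]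
-/

noncomputable section

namespace Summit.CriticalPhenomena.PercolationContinuityZ3.Theorems

namespace Transplant

namespace Skelφ

namespace CorrRec

open Literature.Probability.Percolation Literature.Probability.LatticeModels
open Literature.Probability.Percolation.KozmaNitzan.Cells (oth oth_ne sgOf sgOf_sign eq_oth_of_ne)
open TwoAxis.Para (modulus)
open ChainPlanar ChainPara

/-- A corridor direction that is not a u-direction is a v-direction. [folklore] -/
theorem fst_eq_one_of_ne_zero {du : MDir} (hd : ¬ du.1 = 0) : du.1 = 1 := by
  apply Fin.ext
  have h2 := du.1.isLt
  have h0 : du.1.val ≠ 0 := fun e => hd (Fin.ext e)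
  rw [Fin.val_one]; omega

section Combine

variable {A : ℤ} {n : ℕ} {h v vβ c₀' c₁' D : ℤ} {P : PCells2} {ℓ T : ℕ} {aW bL : ℤ}

/-- The band has `800` strides either way. [folklore] -/
theorem bandNw_N (du : MDir) : (bandNw n ℓ h v T n NC (qy n ℓ h v T aW bL) NC (qy n ℓ h v T aW bL) (Wmy n v) (Wpy n v) du).N = 799 := by
  unfold bandNw; split_ifs <;> rfl

/-- **The structure holding the union of the band and target floors** is avoided: the floors are passed one by one. The REGIONS of the band with
one unit of margin (`hrdB'` of `reachOblRHN_negSG₂b_of_inputs`). [cite: KozmaNitzan2024, §4 Lemma 11 (p. 22), Lemma 12 (pp. 23–25)] -/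
theorem hrdC1 (hn : 1 ≤ n) (hA : 0 < A) (hD : 0 < D) (hm : 0 < modulus n h v vβ) (hc₀ : 0 < c₀')
    (hsc0 : c₀' * A * (40 * modulus n h v vβ) = (P.r 0 : ℤ) * D) (hsc1 : c₁' * A * (40 * modulus n h v vβ) = (P.r 1 : ℤ) * D)
    (hΔlo : (n : ℤ) * ℓ - n < modulus n h v vβ) (hΔhi : modulus n h v vβ ≤ (n : ℤ) * ℓ) (hsT : (T : ℤ) + 1 ≤ sA n ℓ h)
    (hbx1 : modulus n h v vβ * (2 * n + 800 * T) + |v| * ((shearUnit n h : ℤ) * ((qy n ℓ h v T aW bL : ℕ) + 800 * T + (3 * (n * ℓ) / shearUnit n h + 1 : ℕ) + 1))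
      + 3 * modulus n h v vβ * n ≤ 40 * 5 * modulus n h v vβ * n)
    (hbx2 : modulus n h v vβ * (801 * n + 800 * T) + |v| * ((shearUnit n h : ℤ) * ((qy n ℓ h v T aW bL : ℕ) + 800 * T + (3 * (n * ℓ) / shearUnit n h + 1 : ℕ) + 1))
      + 3 * modulus n h v vβ * n ≤ 40 * 22 * modulus n h v vβ * n)
    (hbx3 : (shearUnit n h : ℤ) * ((qy n ℓ h v T aW bL : ℕ) + 800 * T + (3 * (n * ℓ) / shearUnit n h + 1 : ℕ) + 1) + 2 * modulus n h v vβ ≤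
      40 * 2 * modulus n h v vβ)
    (hby1 : (shearUnit n h : ℤ) * (((qy n ℓ h v T aW bL : ℕ) : ℤ) + 800 * T + (3 * (n * ℓ) / shearUnit n h + 1 : ℕ) + 1) + 2 * modulus n h v vβ ≤
      40 * 5 * modulus n h v vβ)
    (hby2 : (shearUnit n h : ℤ) * (799 * ((Qw n ℓ h : ℕ) : ℤ) + (qy n ℓ h v T aW bL : ℕ) + 800 * T + (3 * (n * ℓ) / shearUnit n h + 1 : ℕ) + 1) +
      2 * modulus n h v vβ ≤ 40 * 22 * modulus n h v vβ)
    (hby3 : (P.r 0 : ℤ) * (modulus n h v vβ * (((Wmy n v : ℕ) : ℤ) + (Wpy n v : ℕ) + 800 * T + n) +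
        |v| * ((shearUnit n h : ℤ) * ((2397 + ((qy n ℓ h v T aW bL : ℕ) : ℤ) + 800 * T + (3 * (n * ℓ) / shearUnit n h + 1 : ℕ)) + 1)) +
        |v| * (800 * (n + (shearUnit n h : ℤ)))) + 40 * modulus n h v vβ * n + (P.r 0 : ℤ) * n ≤ 40 * modulus n h v vβ * (n * (2 * (P.r 0 : ℤ)))) :
    ∀ du : MDir, ∀ j ≤ (bandNw n ℓ h v T n NC (qy n ℓ h v T aW bL) NC (qy n ℓ h v T aW bL) (Wmy n v) (Wpy n v) du).N,
      let Bd := bandNw n ℓ h v T n NC (qy n ℓ h v T aW bL) NC (qy n ℓ h v T aW bL) (Wmy n v) (Wpy n v) du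
      let lo := dLo du.1 (sgOf du) 0 (Bd.aLo j - Bd.ea - Bd.La) (Bd.aHi j + Bd.ea + Bd.La) (Bd.bLo j - Bd.eb - Bd.Lb) (Bd.bHi j + Bd.eb + Bd.Lb)
      let hi := dHi du.1 (sgOf du) 0 (Bd.aLo j - Bd.ea - Bd.La) (Bd.aHi j + Bd.ea + Bd.La) (Bd.bLo j - Bd.eb - Bd.Lb) (Bd.bHi j + Bd.eb + Bd.Lb)
      (sgOf du = 1 → -(5 * (P.r du.1 : ℤ)) + 1 ≤ rdLo A n h v vβ c₀' c₁' D lo hi du.1 ∧ rdHi A n h v vβ c₀' c₁' D lo hi du.1 ≤ 22 * (P.r du.1 : ℤ) - 1) ∧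
      (sgOf du = -1 → -(5 * (P.r du.1 : ℤ)) + 1 ≤ -rdHi A n h v vβ c₀' c₁' D lo hi du.1 ∧ -rdLo A n h v vβ c₀' c₁' D lo hi du.1 ≤ 22 * (P.r du.1 : ℤ) - 1) ∧
      (-(2 * (P.r (oth du.1) : ℤ)) + 1 ≤ rdLo A n h v vβ c₀' c₁' D lo hi (oth du.1) ∧
        rdHi A n h v vβ c₀' c₁' D lo hi (oth du.1) ≤ 2 * (P.r (oth du.1) : ℤ) - 1) := by
  intro du j hj
  rw [bandNw_N] at hj
  by_cases hd : du.1 = 0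
  · exact roomsBx hn hA hD hm hc₀ hsc0 hsc1 hbx1 hbx2 hbx3 hd hj
  · exact roomsBy hn hA hD hm hc₀ hsc0 hsc1 hΔlo hΔhi hsT hby1 hby2 hby3 (fst_eq_one_of_ne_zero hd) hj

/-- **The REGIONS of the band without margin** (`hrdB` of `reachOblRHN_negSG₂b`). [cite: KozmaNitzan2024, §4 Lemma 12] -/
theorem hrdC0 (hn : 1 ≤ n) (hA : 0 < A) (hD : 0 < D) (hm : 0 < modulus n h v vβ) (hc₀ : 0 < c₀')
    (hsc0 : c₀' * A * (40 * modulus n h v vβ) = (P.r 0 : ℤ) * D) (hsc1 : c₁' * A * (40 * modulus n h v vβ) = (P.r 1 : ℤ) * D)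
    (hΔlo : (n : ℤ) * ℓ - n < modulus n h v vβ) (hΔhi : modulus n h v vβ ≤ (n : ℤ) * ℓ) (hsT : (T : ℤ) + 1 ≤ sA n ℓ h)
    (hbx1 : modulus n h v vβ * (2 * n + 800 * T) + |v| * ((shearUnit n h : ℤ) * ((qy n ℓ h v T aW bL : ℕ) + 800 * T + (3 * (n * ℓ) / shearUnit n h + 1 : ℕ) + 1))
      + 3 * modulus n h v vβ * n ≤ 40 * 5 * modulus n h v vβ * n)
    (hbx2 : modulus n h v vβ * (801 * n + 800 * T) + |v| * ((shearUnit n h : ℤ) * ((qy n ℓ h v T aW bL : ℕ) + 800 * T + (3 * (n * ℓ) / shearUnit n h + 1 : ℕ) + 1))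
      + 3 * modulus n h v vβ * n ≤ 40 * 22 * modulus n h v vβ * n)
    (hbx3 : (shearUnit n h : ℤ) * ((qy n ℓ h v T aW bL : ℕ) + 800 * T + (3 * (n * ℓ) / shearUnit n h + 1 : ℕ) + 1) + 2 * modulus n h v vβ ≤
      40 * 2 * modulus n h v vβ)
    (hby1 : (shearUnit n h : ℤ) * (((qy n ℓ h v T aW bL : ℕ) : ℤ) + 800 * T + (3 * (n * ℓ) / shearUnit n h + 1 : ℕ) + 1) + 2 * modulus n h v vβ ≤
      40 * 5 * modulus n h v vβ)
    (hby2 : (shearUnit n h : ℤ) * (799 * ((Qw n ℓ h : ℕ) : ℤ) + (qy n ℓ h v T aW bL : ℕ) + 800 * T + (3 * (n * ℓ) / shearUnit n h + 1 : ℕ) + 1) +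
      2 * modulus n h v vβ ≤ 40 * 22 * modulus n h v vβ)
    (hby3 : (P.r 0 : ℤ) * (modulus n h v vβ * (((Wmy n v : ℕ) : ℤ) + (Wpy n v : ℕ) + 800 * T + n) +
        |v| * ((shearUnit n h : ℤ) * ((2397 + ((qy n ℓ h v T aW bL : ℕ) : ℤ) + 800 * T + (3 * (n * ℓ) / shearUnit n h + 1 : ℕ)) + 1)) +
        |v| * (800 * (n + (shearUnit n h : ℤ)))) + 40 * modulus n h v vβ * n + (P.r 0 : ℤ) * n ≤ 40 * modulus n h v vβ * (n * (2 * (P.r 0 : ℤ)))) :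
    ∀ du : MDir, ∀ j ≤ (bandNw n ℓ h v T n NC (qy n ℓ h v T aW bL) NC (qy n ℓ h v T aW bL) (Wmy n v) (Wpy n v) du).N,
      let Bd := bandNw n ℓ h v T n NC (qy n ℓ h v T aW bL) NC (qy n ℓ h v T aW bL) (Wmy n v) (Wpy n v) du
      let lo := dLo du.1 (sgOf du) 0 (Bd.aLo j - Bd.ea - Bd.La) (Bd.aHi j + Bd.ea + Bd.La) (Bd.bLo j - Bd.eb - Bd.Lb) (Bd.bHi j + Bd.eb + Bd.Lb)
      let hi := dHi du.1 (sgOf du) 0 (Bd.aLo j - Bd.ea - Bd.La) (Bd.aHi j + Bd.ea + Bd.La) (Bd.bLo j - Bd.eb - Bd.Lb) (Bd.bHi j + Bd.eb + Bd.Lb)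
      (sgOf du = 1 → -(5 * (P.r du.1 : ℤ)) ≤ rdLo A n h v vβ c₀' c₁' D lo hi du.1 ∧ rdHi A n h v vβ c₀' c₁' D lo hi du.1 ≤ 22 * (P.r du.1 : ℤ)) ∧
      (sgOf du = -1 → -(5 * (P.r du.1 : ℤ)) ≤ -rdHi A n h v vβ c₀' c₁' D lo hi du.1 ∧ -rdLo A n h v vβ c₀' c₁' D lo hi du.1 ≤ 22 * (P.r du.1 : ℤ)) ∧
      (-(2 * (P.r (oth du.1) : ℤ)) ≤ rdLo A n h v vβ c₀' c₁' D lo hi (oth du.1) ∧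
        rdHi A n h v vβ c₀' c₁' D lo hi (oth du.1) ≤ 2 * (P.r (oth du.1) : ℤ)) := by
  intro du j hj
  obtain ⟨a, b, c⟩ := hrdC1 hn hA hD hm hc₀ hsc0 hsc1 hΔlo hΔhi hsT hbx1 hbx2 hbx3 hby1 hby2 hby3 du j hj
  exact ⟨fun hs => ⟨by linarith [(a hs).1], by linarith [(a hs).2]⟩, fun hs => ⟨by linarith [(b hs).1], by linarith [(b hs).2]⟩,
    by linarith [c.1], by linarith [c.2]⟩

/-- **The LAST CORE of the band lies in the next cell's arrival box `cen' ± (b₀ − 1)`** (`hrdL`), either axis and sign, under the target floors.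
[cite: KozmaNitzan2024, §4 Lemma 12 (pp. 23–25), p. 26 (M_v)] -/
theorem hrdLC (hn : 1 ≤ n) (hA : 0 < A) (hD : 0 < D) (hm : 0 < modulus n h v vβ) (hc₀ : 0 < c₀')
    (hsc0 : c₀' * A * (40 * modulus n h v vβ) = (P.r 0 : ℤ) * D) (hsc1 : c₁' * A * (40 * modulus n h v vβ) = (P.r 1 : ℤ) * D)
    (hΔlo : (n : ℤ) * ℓ - n < modulus n h v vβ) (hΔhi : modulus n h v vβ ≤ (n : ℤ) * ℓ) (b₀ : Fin 2 → ℕ)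
    (hxL1 : 40 * modulus n h v vβ * n * (20 * (P.r 0 : ℤ) - (b₀ 0 : ℕ) + 1) + (P.r 0 : ℤ) * n +
      (P.r 0 : ℤ) * (|v| * ((shearUnit n h : ℤ) * ((qy n ℓ h v T aW bL : ℕ) + 800 * T + 1))) ≤ (P.r 0 : ℤ) * (modulus n h v vβ * (799 * n - 800 * T)))
    (hxL3 : (P.r 1 : ℤ) * ((shearUnit n h : ℤ) * ((qy n ℓ h v T aW bL : ℕ) + 800 * T + 1)) + 40 * modulus n h v vβ ≤ 40 * modulus n h v vβ * (b₀ 1 : ℕ))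
    (hyL1 : 40 * modulus n h v vβ * (20 * (P.r 1 : ℤ) - (b₀ 1 : ℕ) + 1) + (P.r 1 : ℤ) * ((shearUnit n h : ℤ) - 1) <
      (P.r 1 : ℤ) * ((shearUnit n h : ℤ) * (800 * sA n ℓ h - (qy n ℓ h v T aW bL : ℕ) - 800 * T)))
    (hyL2 : (P.r 1 : ℤ) * ((shearUnit n h : ℤ) * (800 * ((Qw n ℓ h : ℕ) : ℤ) + (qy n ℓ h v T aW bL : ℕ) + 800 * T) + shearUnit n h - 1) <
      40 * modulus n h v vβ * (20 * (P.r 1 : ℤ) + (b₀ 1 : ℕ) - 1))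
    (hyL3 : (P.r 0 : ℤ) * (modulus n h v vβ * (((Wmy n v : ℕ) : ℤ) + (Wpy n v : ℕ) + 800 * T) +
        |v| * ((shearUnit n h : ℤ) * ((2400 + ((qy n ℓ h v T aW bL : ℕ) : ℤ) + 800 * T) + 1)) + |v| * (800 * (n + (shearUnit n h : ℤ)))) +
        40 * modulus n h v vβ * n + (P.r 0 : ℤ) * n ≤ 40 * modulus n h v vβ * (n * ((b₀ 0 : ℕ) : ℤ))) :
    ∀ du : MDir,
      let Bd := bandNw n ℓ h v T n NC (qy n ℓ h v T aW bL) NC (qy n ℓ h v T aW bL) (Wmy n v) (Wpy n v) du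
      let lo := dLo du.1 (sgOf du) 0 (Bd.aLo (Bd.N + 1)) (Bd.aHi (Bd.N + 1)) (Bd.bLo (Bd.N + 1)) (Bd.bHi (Bd.N + 1))
      let hi := dHi du.1 (sgOf du) 0 (Bd.aLo (Bd.N + 1)) (Bd.aHi (Bd.N + 1)) (Bd.bLo (Bd.N + 1)) (Bd.bHi (Bd.N + 1))
      (sgOf du = 1 → 20 * (P.r du.1 : ℤ) - (b₀ du.1 : ℕ) + 1 ≤ rdLo A n h v vβ c₀' c₁' D lo hi du.1 ∧
        rdHi A n h v vβ c₀' c₁' D lo hi du.1 ≤ 20 * (P.r du.1 : ℤ) + (b₀ du.1 : ℕ) - 1) ∧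
      (sgOf du = -1 → 20 * (P.r du.1 : ℤ) - (b₀ du.1 : ℕ) + 1 ≤ -rdHi A n h v vβ c₀' c₁' D lo hi du.1 ∧
        -rdLo A n h v vβ c₀' c₁' D lo hi du.1 ≤ 20 * (P.r du.1 : ℤ) + (b₀ du.1 : ℕ) - 1) ∧
      (-((b₀ (oth du.1) : ℕ) : ℤ) + 1 ≤ rdLo A n h v vβ c₀' c₁' D lo hi (oth du.1) ∧
        rdHi A n h v vβ c₀' c₁' D lo hi (oth du.1) ≤ ((b₀ (oth du.1) : ℕ) : ℤ) - 1) := by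
  intro du
  by_cases hd : du.1 = 0
  · exact roomsLx hn hA hD hm hc₀ hsc0 hsc1 b₀ hxL1 hxL3 hd
  · exact roomsLy hn hA hD hm hc₀ hsc0 hsc1 hΔlo hΔhi b₀ hyL1 hyL2 hyL3 (fst_eq_one_of_ne_zero hd)

/-! ## The habitat points -/

/-- **The habitat points of the band cores by corridor axis.** [this work] -/
def zB (n ℓ : ℕ) (h v : ℤ) (du : MDir) (j : ℕ) : Site 2 := if du.1 = 0 then zBx n (sgOf du) j else zBy n ℓ h v (sgOf du) j

/-- **The habitat point of core `1 ≤ j ≤ N + 1` lies in core `j`** (`hzB`). [folklore] -/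
theorem zB_mem (hn : 1 ≤ n) : ∀ (du : MDir) (j : ℕ), 1 ≤ j →
    j ≤ (bandNw n ℓ h v T n NC (qy n ℓ h v T aW bL) NC (qy n ℓ h v T aW bL) (Wmy n v) (Wpy n v) du).N + 1 →
      zB n ℓ h v du j ∈ (bandNw n ℓ h v T n NC (qy n ℓ h v T aW bL) NC (qy n ℓ h v T aW bL) (Wmy n v) (Wpy n v) du).pcore du.1 (sgOf du) 0 j := by
  intro du j hj1 hj
  by_cases hd : du.1 = 0
  · rw [zB, if_pos hd]; exact zBx_mem hd hj1 hj
  · rw [zB, if_neg hd]; exact zBy_mem hn (fst_eq_one_of_ne_zero hd) hj1 hj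

/-- **The habitat points are within `Zmax := 800·(n + W_B)` of the origin** (`hZ`). [folklore] -/
theorem zB_l1 (hvn : |v| ≤ n) : ∀ (du : MDir) (j : ℕ), ((zB n ℓ h v du j) 0).natAbs + ((zB n ℓ h v du j) 1).natAbs ≤ 800 * (n + Qw n ℓ h) := by
  intro du j
  by_cases hd : du.1 = 0
  · rw [zB, if_pos hd]
    exact (zBx_l1 (sgOf du) (sgOf_sign du) j).trans (Nat.mul_le_mul_left _ (Nat.le_add_right _ _))
  · rw [zB, if_neg hd]; exact zBy_l1 hvn (sgOf du) (sgOf_sign du) j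

/-- **The habitat points read inside the rooms with one unit of margin** (`hrdZ`), either axis and sign, under the band floors.
[cite: KozmaNitzan2024, §4 p. 26 (H_{v,x})] -/
theorem hrdZC (hn : 1 ≤ n) (hA : 0 < A) (hD : 0 < D) (hm : 0 < modulus n h v vβ) (hc₀ : 0 < c₀')
    (hsc0 : c₀' * A * (40 * modulus n h v vβ) = (P.r 0 : ℤ) * D) (hsc1 : c₁' * A * (40 * modulus n h v vβ) = (P.r 1 : ℤ) * D)
    (hΔlo : (n : ℤ) * ℓ - n < modulus n h v vβ) (hΔhi : modulus n h v vβ ≤ (n : ℤ) * ℓ)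
    (hbx1 : modulus n h v vβ * (2 * n + 800 * T) + |v| * ((shearUnit n h : ℤ) * ((qy n ℓ h v T aW bL : ℕ) + 800 * T + (3 * (n * ℓ) / shearUnit n h + 1 : ℕ) + 1))
      + 3 * modulus n h v vβ * n ≤ 40 * 5 * modulus n h v vβ * n)
    (hbx2 : modulus n h v vβ * (801 * n + 800 * T) + |v| * ((shearUnit n h : ℤ) * ((qy n ℓ h v T aW bL : ℕ) + 800 * T + (3 * (n * ℓ) / shearUnit n h + 1 : ℕ) + 1))
      + 3 * modulus n h v vβ * n ≤ 40 * 22 * modulus n h v vβ * n)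
    (hbx3 : (shearUnit n h : ℤ) * ((qy n ℓ h v T aW bL : ℕ) + 800 * T + (3 * (n * ℓ) / shearUnit n h + 1 : ℕ) + 1) + 2 * modulus n h v vβ ≤
      40 * 2 * modulus n h v vβ)
    (hby1 : (shearUnit n h : ℤ) * (((qy n ℓ h v T aW bL : ℕ) : ℤ) + 800 * T + (3 * (n * ℓ) / shearUnit n h + 1 : ℕ) + 1) + 2 * modulus n h v vβ ≤
      40 * 5 * modulus n h v vβ)
    (hby2 : (shearUnit n h : ℤ) * (799 * ((Qw n ℓ h : ℕ) : ℤ) + (qy n ℓ h v T aW bL : ℕ) + 800 * T + (3 * (n * ℓ) / shearUnit n h + 1 : ℕ) + 1) +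
      2 * modulus n h v vβ ≤ 40 * 22 * modulus n h v vβ)
    (hby3 : (P.r 0 : ℤ) * (modulus n h v vβ * (((Wmy n v : ℕ) : ℤ) + (Wpy n v : ℕ) + 800 * T + n) +
        |v| * ((shearUnit n h : ℤ) * ((2397 + ((qy n ℓ h v T aW bL : ℕ) : ℤ) + 800 * T + (3 * (n * ℓ) / shearUnit n h + 1 : ℕ)) + 1)) +
        |v| * (800 * (n + (shearUnit n h : ℤ)))) + 40 * modulus n h v vβ * n + (P.r 0 : ℤ) * n ≤ 40 * modulus n h v vβ * (n * (2 * (P.r 0 : ℤ)))) :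
    ∀ (du : MDir) (j : ℕ),
      (sgOf du = 1 → -(5 * (P.r du.1 : ℤ)) + 1 ≤ rdLo A n h v vβ c₀' c₁' D (zB n ℓ h v du j) (zB n ℓ h v du j) du.1 ∧
        rdHi A n h v vβ c₀' c₁' D (zB n ℓ h v du j) (zB n ℓ h v du j) du.1 ≤ 22 * (P.r du.1 : ℤ) - 1) ∧
      (sgOf du = -1 → -(5 * (P.r du.1 : ℤ)) + 1 ≤ -rdHi A n h v vβ c₀' c₁' D (zB n ℓ h v du j) (zB n ℓ h v du j) du.1 ∧
        -rdLo A n h v vβ c₀' c₁' D (zB n ℓ h v du j) (zB n ℓ h v du j) du.1 ≤ 22 * (P.r du.1 : ℤ) - 1) ∧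
      (-(2 * (P.r (oth du.1) : ℤ)) + 1 ≤ rdLo A n h v vβ c₀' c₁' D (zB n ℓ h v du j) (zB n ℓ h v du j) (oth du.1) ∧
        rdHi A n h v vβ c₀' c₁' D (zB n ℓ h v du j) (zB n ℓ h v du j) (oth du.1) ≤ 2 * (P.r (oth du.1) : ℤ) - 1) := by
  intro du j
  by_cases hd : du.1 = 0
  · rw [zB, if_pos hd]; exact roomsZx hn hA hD hm hc₀ hsc0 hsc1 hbx1 hbx2 hbx3 hd j
  · rw [zB, if_neg hd]; exact roomsZy hn hA hD hm hc₀ hsc0 hsc1 hΔlo hΔhi hby1 hby2 hby3 (fst_eq_one_of_ne_zero hd) j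

end Combine

end CorrRec

end Skelφ

end Transplant

end Summit.CriticalPhenomena.PercolationContinuityZ3.Theorems

end
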